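import Summits.SmoothPoincare4.SmoothPoincare4.Theorems.CongruenceShadowsShadowApproximationStubLayerStepTwoZeroAssembly
import HarnessLib

/-!
# Helper for stub `stub_layerStepBlockZero` (line `nilpotent-genus-class`, crux
`CongruenceShadows.ShadowApproximation`, item stmt-SmoothPoincare4-14595):
# the layer step `(m, 0)` at every genus `3 + 3m` from elementary realisers

`S = SurfaceGroup (3+3m)`, `N i = s4Kernels.stabilizeIter m i`, `γₖ₊₁ = (⊤).lowerCentralSeries k`.
`layerStepBlock_of_realisers`: GIVEN, for the erasing projection `π` of slot `2` and all handles `a, b, c`, a Goeritz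
IA-automorphism `y_{abc} ∈ Stab N₀ ∩ Stab N₁` reading as a form `D_{abc}` which is `± e_{abc}` (the elementary
alternating form, on `v < w`) whenever `a < b < c` is an ALLOWED triple (not all `≡ 1`, not all `≡ 2 (mod 3)`), THEN the
layer step at `(m, 0)` holds: for a kernel triple `K` of genus `3 + 3m` with `K 0 = N 0`, `K 1 = N 1`, Waldhausen pairs
and `K 2 γ₂ = N 2 γ₂`, some `y ∈ Stab N₀ ∩ Stab N₁` has `y(N₂ γ₃) = K₂ γ₃`, granted (AUTSYMP) at genus `3 + 3m`.
Proof — the landed genus-`9` `layerStep9_of_certificate` made uniform in the genus: slot-keeping pair normalisations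
`α' ∈ IA ∩ Stab N₀`, `β' ∈ IA ∩ Stab N₁` with `α'(N₂) = β'(N₂) = K₂` (`exists_ia_stab_of_pair_stabilizeIter`); the reading
`D` of `α'` is alternating (`reading_ia_g`) and VANISHES on the triples of handles all `≡ 1` (`reading_eq_zero_of_map_stabilizeIter_eq`
for `α'`) and all `≡ 2` (the same for `β'`, transferred by `forms_eq_of_map_eq`); so `D = ∑_{allowed a<b<c} D_{abc} e_{abc}`
on `v < w` (`alt_eq_sum_elementary`), and `y = ∏ y_{abc} ^ (± D_{abc})` reads as `D` (`reading_list_prod_zpow`), whence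
`y(N₂)γ₃ = α'(N₂)γ₃ = K₂γ₃` (`map_sup_eq_of_forms_g`).  No definitions; the realisers live in …BlockZeroReading, the data in
the stub file.
-/

set_option linter.dupNamespace false

noncomputable section

open Subgroup Literature.Topology.FourManifolds Literature.Algebra.Lie Multiplicative
open Summit.SmoothPoincare4.SmoothPoincare4.Theorems.NilpotentShadowsStandard.SaturatedTorsorDescent
open scoped commutatorElement

namespace Summit.SmoothPoincare4.SmoothPoincare4.Theorems.ShadowApproximation.NilpotentGenusClass

/-! ## The layer step `(m, 0)` from elementary realisers -/

section Realisers

variable {m : ℕ}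

/-- **The layer step `(m, 0)` from elementary realisers** (see the module docstring). [folklore] -/
theorem layerStepBlock_of_realisers
    (hreal : ∀ {π : SurfaceGroup (3 + 3 * m) →* FreeGroup (Fin (3 + 3 * m))}, Function.Surjective π →
      (∀ (h : Fin (3 + 3 * m)) (b : Bool), π (PresentedGroup.of (h, b)) = if b = decide (((h : Fin (3 + 3 * m)) : ℕ) % 3 = 0) then 1 else FreeGroup.of h) →
      ∀ a b c : Fin (3 + 3 * m), ∃ y : SurfaceGroup (3 + 3 * m) ≃* SurfaceGroup (3 + 3 * m), (s4Kernels.stabilizeIter m 0).map y.toMonoidHom = s4Kernels.stabilizeIter m 0 ∧ (s4Kernels.stabilizeIter m 1).map y.toMonoidHom = s4Kernels.stabilizeIter m 1 ∧ (∀ t : SurfaceGroup (3 + 3 * m), y t * t⁻¹ ∈ ((⊤ : Subgroup (SurfaceGroup (3 + 3 * m))).lowerCentralSeries 1)) ∧ ∃ (D : Fin (3 + 3 * m) → Fin (3 + 3 * m) → Fin (3 + 3 * m) → ℤ) (s : ℤ), (s = 1 ∨ s = -1) ∧ (∀ j : Fin (3 + 3 * m), π (y (PresentedGroup.of (j, decide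 (((j : Fin (3 + 3 * m)) : ℕ) % 3 = 0))) * (PresentedGroup.of (j, decide (((j : Fin (3 + 3 * m)) : ℕ) % 3 = 0)))⁻¹) * (((List.finRange (3 + 3 * m)).map (fun v => ((List.finRange (3 + 3 * m)).map (fun w => if v < w then ⁅(FreeGroup.of v : FreeGroup (Fin (3 + 3 * m))), FreeGroup.of w⁆ ^ ((if decide (((j : Fin (3 + 3 * m)) : ℕ) % 3 = 0) then (-1 : ℤ) else 1) * D j v w) else (1 : FreeGroup (Fin (3 + 3 * m))))).prod)).prod)⁻¹ ∈ ((⊤ : Subgroup (FreeGroup (Fin (3 + 3 * m)))).lowerCentralSeries 2)) ∧ ((a < b) → (b < c) → ¬((((a : Fin (3 + 3 * m)) : ℕ) % 3 = 1) ∧ (((b : Fin (3 + 3 * m)) : ℕ) % 3 = 1) ∧ (((c : Fin (3 + 3 * m)) : ℕ) % 3 = 1)) → ¬((((a : Fin (3 + 3 * m)) : ℕ) % 3 = 2) ∧ (((b : Fin (3 + 3 * m)) : ℕ) % 3 = 2) ∧ (((c : Fin (3 + 3 * m)) : ℕ) % 3 = 2)) → ∀ j v w : Fin (3 + 3 * m),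 v < w → D j v w = s * (if j = a ∧ v = b ∧ w = c then (1 : ℤ) else if j = c ∧ v = a ∧ w = b then (1 : ℤ) else if j = b ∧ v = a ∧ w = c then (-1 : ℤ) else 0)))
    (hA : (∀ (φ : (SurfaceGroup (3 + 3 * m)) ≃* (SurfaceGroup (3 + 3 * m))), ∃ (F : (surfaceGen (3 + 3 * m) → ℤ) ≃ₗ[ℤ] (surfaceGen (3 + 3 * m) → ℤ)) (ε : ℤ),
      (ε = 1 ∨ ε = -1) ∧ (∀ s : (SurfaceGroup (3 + 3 * m)), toAdd (SurfaceGroup.abelianize (3 + 3 * m) (φ s)) =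
        F (toAdd (SurfaceGroup.abelianize (3 + 3 * m) s))) ∧
        ∀ u v : surfaceGen (3 + 3 * m) → ℤ, symplForm (F u) (F v) = ε * symplForm u v))
    (K : TrisectionKernels (3 + 3 * m)) (hK0 : K 0 = s4Kernels.stabilizeIter m 0) (hK1 : K 1 = s4Kernels.stabilizeIter m 1)
    (hW : ∀ i j : Fin 3, i ≠ j → ∃ α : (SurfaceGroup (3 + 3 * m)) ≃* (SurfaceGroup (3 + 3 * m)),
      (s4Kernels.stabilizeIter m i).map α.toMonoidHom = K i ∧ (s4Kernels.stabilizeIter m j).map α.toMonoidHom = K j)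
    (hK2 : K 2 ⊔ ((⊤ : Subgroup (SurfaceGroup (3 + 3 * m))).lowerCentralSeries 1) = s4Kernels.stabilizeIter m 2 ⊔ ((⊤ : Subgroup (SurfaceGroup (3 + 3 * m))).lowerCentralSeries 1)) :
    ∃ y : (SurfaceGroup (3 + 3 * m)) ≃* (SurfaceGroup (3 + 3 * m)),
      (s4Kernels.stabilizeIter m 0).map y.toMonoidHom = s4Kernels.stabilizeIter m 0 ∧
      (s4Kernels.stabilizeIter m 1).map y.toMonoidHom = s4Kernels.stabilizeIter m 1 ∧
      (s4Kernels.stabilizeIter m 2 ⊔ ((⊤ : Subgroup (SurfaceGroup (3 + 3 * m))).lowerCentralSeries 2)).map y.toMonoidHom = K 2 ⊔ ((⊤ : Subgroup (SurfaceGroup (3 + 3 * m))).lowerCentralSeries 2) := by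
  classical
  -- (1) slot-keeping pair normalisations from the pairs `(0,2)` and `(1,2)`
  obtain ⟨α, hα0, hα2⟩ := hW 0 2 (by decide)
  rw [hK0] at hα0
  obtain ⟨α', hα'IA, hα'0, hα'2⟩ := exists_ia_stab_of_pair_stabilizeIter (m := m) hA (i := 0) (by decide) hα0 hα2 hK2
  obtain ⟨β, hβ1, hβ2⟩ := hW 1 2 (by decide)
  rw [hK1] at hβ1
  obtain ⟨β', hβ'IA, hβ'1, hβ'2⟩ := exists_ia_stab_of_pair_stabilizeIter (m := m) hA (i := 1) (by decide) hβ1 hβ2 hK2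
  -- (2) the cut dictionary of slot `2` (cut letters `bⱼ` on `j ≡ 0`, `aⱼ` elsewhere)
  obtain ⟨ct, π, hct, hπs, hπker, hπof⟩ := helper_glueErasePi m 2 (stub_cutNormalForm m 2)
  have hctf : ct = fun h : Fin (3 + 3 * m) => decide ((h : ℕ) % 3 = 0) := by
    funext h
    have hm : (h, decide ((((h : ℕ)) + ((2 : Fin 3) : ℕ)) % 3 = 2)) ∈ s4CutSystem m 2 := by
      rw [s4CutSystem_eq_range]; exact ⟨h, rfl⟩
    rw [← (hct h _).1 hm]
    simp only [Fin.val_two]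
    by_cases hh : (h : ℕ) % 3 = 0
    · rw [decide_eq_true hh, decide_eq_true (by omega)]
    · rw [decide_eq_false hh, decide_eq_false (by omega)]
  subst hctf
  -- (3) the readings of `α'`, `β'`; the vanishing coordinates of the honest datum
  obtain ⟨Dα, hDα1, hDα2, hDα⟩ := reading_ia_g hπs hπker hπof α' hα'IA
  obtain ⟨Dβ, -, -, hDβ⟩ := reading_ia_g hπs hπker hπof β' hβ'IA
  have hmem : ∀ (i : Fin 3) (h : Fin (3 + 3 * m)), (((h : ℕ) + (i : ℕ)) % 3 = 2 ↔ (h : ℕ) % 3 = 0) →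
      (h, decide ((h : ℕ) % 3 = 0)) ∈ s4CutSystem m i := by
    intro i h hiff
    have e : decide ((h : ℕ) % 3 = 0) = decide ((((h : Fin (3 + 3 * m)) : ℕ) + (i : ℕ)) % 3 = 2) := by
      by_cases hh : (h : ℕ) % 3 = 0
      · rw [decide_eq_true hh, decide_eq_true (hiff.2 hh)]
      · rw [decide_eq_false hh, decide_eq_false (fun h' => hh (hiff.1 h'))]
    rw [e]; exact mem_s4CutSystem_of_decide i h
  have hz1 : ∀ a b c : Fin (3 + 3 * m), b < c → (a : ℕ) % 3 = 1 → (b : ℕ) % 3 = 1 → (c : ℕ) % 3 = 1 → Dα a b c = 0 :=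
    fun a b c hbc ha hb hc => reading_eq_zero_of_map_stabilizeIter_eq hπs hπof 0 α' hα'IA hα'0 Dα hDα a b c hbc
      (hmem 0 a (by simp only [Fin.val_zero]; omega)) (hmem 0 b (by simp only [Fin.val_zero]; omega))
      (hmem 0 c (by simp only [Fin.val_zero]; omega))
  have hz2 : ∀ a b c : Fin (3 + 3 * m), b < c → (a : ℕ) % 3 = 2 → (b : ℕ) % 3 = 2 → (c : ℕ) % 3 = 2 → Dα a b c = 0 := by
    intro a b c hbc ha hb hc
    rw [forms_eq_of_map_eq hπs hπker hπof α' β' hα'IA hβ'IA Dα Dβ hDα hDβ (hα'2.trans hβ'2.symm) a b c hbc]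
    exact reading_eq_zero_of_map_stabilizeIter_eq hπs hπof 1 β' hβ'IA hβ'1 Dβ hDβ a b c hbc
      (hmem 1 a (by simp only [Fin.val_one]; omega)) (hmem 1 b (by simp only [Fin.val_one]; omega))
      (hmem 1 c (by simp only [Fin.val_one]; omega))
  -- (4) the realisers and their readings, for every triple of handles
  have hreal' := fun (a b c : Fin (3 + 3 * m)) => hreal hπs hπof a b c
  choose Y hY0 hY1 hYIA DY sY hsY hYD hYc using hreal'
  -- (5) the exponents and the product realiser over `ι = Fin (3+3m) × Fin (3+3m) × Fin (3+3m)`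
  set nexp : Fin (3 + 3 * m) × Fin (3 + 3 * m) × Fin (3 + 3 * m) → ℤ := fun i =>
    if i.1 < i.2.1 ∧ i.2.1 < i.2.2 then sY i.1 i.2.1 i.2.2 * Dα i.1 i.2.1 i.2.2 else 0 with hnexp
  obtain ⟨hyIA, hyD⟩ := reading_list_prod_zpow (Finset.univ.toList) (fun i : Fin (3 + 3 * m) × Fin (3 + 3 * m) × Fin (3 + 3 * m) => Y i.1 i.2.1 i.2.2)
    nexp (fun i => hYIA _ _ _) (fun i => DY i.1 i.2.1 i.2.2) (fun i => hYD _ _ _)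
  refine ⟨((Finset.univ.toList).map fun i : Fin (3 + 3 * m) × Fin (3 + 3 * m) × Fin (3 + 3 * m) =>
      ((Y i.1 i.2.1 i.2.2 : MulAut (SurfaceGroup (3 + 3 * m))) ^ nexp i : MulAut (SurfaceGroup (3 + 3 * m)))).prod,
    map_list_prod_eq_of_forall _ _ _ fun i => map_zpow_eq_of_map_eq (Y i.1 i.2.1 i.2.2) (hY0 _ _ _) _,
    map_list_prod_eq_of_forall _ _ _ fun i => map_zpow_eq_of_map_eq (Y i.1 i.2.1 i.2.2) (hY1 _ _ _) _, ?_⟩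
  -- (6) equal readings: the certificates of the allowed triples
  have heq : ∀ j v w : Fin (3 + 3 * m), v < w →
      ((Finset.univ.toList).map fun i : Fin (3 + 3 * m) × Fin (3 + 3 * m) × Fin (3 + 3 * m) => nexp i * DY i.1 i.2.1 i.2.2 j v w).sum = Dα j v w := by
    intro j v w hvw
    rw [Finset.sum_map_toList, alt_eq_sum_elementary Dα hDα1 hDα2 j v w hvw, Fintype.sum_prod_type]
    refine Finset.sum_congr rfl fun a _ => ?_
    rw [Fintype.sum_prod_type]
    refine Finset.sum_congr rfl fun b _ => Finset.sum_congr rfl fun c _ => ?_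
    simp only [hnexp]
    by_cases habc : a < b ∧ b < c
    · rw [if_pos habc, if_pos habc]
      by_cases hx1 : ((a : ℕ) % 3 = 1 ∧ (b : ℕ) % 3 = 1 ∧ (c : ℕ) % 3 = 1)
      · rw [hz1 a b c habc.2 hx1.1 hx1.2.1 hx1.2.2, mul_zero, zero_mul, zero_mul]
      by_cases hx2 : ((a : ℕ) % 3 = 2 ∧ (b : ℕ) % 3 = 2 ∧ (c : ℕ) % 3 = 2)
      · rw [hz2 a b c habc.2 hx2.1 hx2.2.1 hx2.2.2, mul_zero, zero_mul, zero_mul]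
      rw [hYc a b c habc.1 habc.2 hx1 hx2 j v w hvw]
      rcases hsY a b c with hs | hs <;> rw [hs] <;> ring
    · rw [if_neg habc, if_neg habc, zero_mul]
  rw [map_sup_eq_of_forms_g hct hπs hπker hπof _ α' hyIA hα'IA _ Dα hyD hDα heq, hα'2]

end Realisers

/-! ## Registered helper -/

/-- **Registered helper `helper_allowedOfLt`** (sub-goal of stub `stub_layerStepBlockZero`, crux stmt-SmoothPoincare4-14595;
the file's main theorem `layerStepBlock_of_realisers` exceeds the registry's signature size): an increasing triple of
handles of `Fin n` whose middle handle is `≡ 0 (mod 3)` is allowed (neither all `≡ 1` nor all `≡ 2`). [folklore] -/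
theorem helper_allowedOfLt : ∀ (n : ℕ) (a b c : Fin n), a < b → b < c → ((b : Fin n) : ℕ) % 3 = 0 → ¬(((a : Fin n) : ℕ) % 3 = 1 ∧ ((b : Fin n) : ℕ) % 3 = 1 ∧ ((c : Fin n) : ℕ) % 3 = 1) ∧ ¬(((a : Fin n) : ℕ) % 3 = 2 ∧ ((b : Fin n) : ℕ) % 3 = 2 ∧ ((c : Fin n) : ℕ) % 3 = 2) :=
  fun _ _ _ _ _ _ hb => ⟨fun h => by omega, fun h => by omega⟩

end Summit.SmoothPoincare4.SmoothPoincare4.Theorems.ShadowApproximation.NilpotentGenusClass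

end
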